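import Summits.BirchSwinnertonDyer.Rank1Residual.GaloisImage.KolyvaginDerivativeUnramified
import HarnessLib

/-!
# Kolyvagin's derivative classes are unramified where the Euler-system class is — CLASS-LEVEL form
# (`res_{I_𝔓} κ_r = 0` in `H¹(I_𝔓, T′)`, no triviality of inertia on the coefficients)
# (cell `b2b-bsdres`, team n1011, seat p11 GEN 8, OWNERS row T-DER = skel/T-DER.md STATUS v5/v6; file F7′)

HONEST FRAMING (cell `b2b-bsdres`, run/shared/lean/b2b/bsd-rank1-residual/, verbatim in every
file): the goal of the cell is to DELETE the COMBINATION-SHAPED residual classes of the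
Birch–Swinnerton-Dyer formula for ALL analytic-rank `≤ 1` elliptic curves over `ℚ` — "full BSD
formula for every rank `≤ 1` curve in class `C`" assembled STRICTLY from published theorems — so
that the rank-`≤ 1` remainder becomes exactly the CONSTRUCTION-SHAPED classes, which are TYPED
(missing-input `Prop`s), NOT attempted. This is not "finishing BSD". Team n1011: research route on
the CONSTRUCTION-SHAPED class X4; no claim beyond the stated classes; nothing is booked. TOOL
theorems of continuous group cohomology (no definition, no named fact, no `sorry`); curve-free,
`p`-free, Euler-system-free.

## What

F7 (`KolyvaginDerivativeUnramified.lean`) tracks the COCYCLE-LEVEL condition "every representative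
vanishes on `S`", adequate where `S` (the inertia groups above `v`) acts trivially on the
coefficients.  This file tracks the CLASS-LEVEL condition **`res_I y = 0 ∈ H¹(I, X)` for every
subgroup `I` of a conjugation-stable family `𝓘` inside `H`** (`resLe`), which is the meaning of
"unramified at `v`" for RAMIFIED coefficients as well (the bad places `v ∣ N`, `v ∤ p` of THEOREM B,
[MR04] Remark A.5's structure `𝓕_u`):
§1 `resLe_eq_zero_iff_exists` (cocycle description), stability under `+`/`−`, under `conjMap`
(`(g·φ)|_I = ∂(g·w)` when `φ|_{g⁻¹ I g} = ∂w`), under Kolyvagin's `D_r` (F7's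
`noncommProd_deriv_apply_mem`), under coefficient change (F3a `red_resLe`, NO hypothesis on the
action), and DESCENT `resSubgroup X I 1 κ = resLe (I ≤ H) 1 (resSubgroup X H 1 κ)`;
§2 **THEOREM B-ur (class level)** `resSubgroup_inertia_eq_zero_of_resSubgroup_eq_deriv`: over a
number field, for `U ⊴ Γ_K` open and unramified at `v`, ANY `red : X ⟶ X′` and `x ∈ H¹(U, X)` with
`res_{I_𝔓} x = 0` for all `𝔓 ∣ v`: every `κ ∈ H¹(Γ_K, X′)` with `res_U κ = D_r (red_* x)` has
`res_{I_𝔓} κ = 0` for all `𝔓 ∣ v`; §3 the bridge to F7/F9: `res_{I} κ = 0` iff some representative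
of `κ` vanishes on `I` (`exists_apply_eq_zero_of_resSubgroup_eq_zero`), so F9
(`SelmerFinite.localization_mem_unramifiedSubgroup_of_apply_eq_zero`) turns the conclusion at
`𝔓₀` into `loc_v ∈ H¹_ur(K_v, ·)` in `ℤ`-currency.  The INPUT at a bad place (`res_{I} c_{⊥,r} = 0`)
is NOT supplied here (Kato's `H¹(ℤ[ζ_m, 1/p], T)` clause if typed so, or [Rubin00] Cor. B.3.4's
universal norms) — skel/T-DER.md STATUS v6.

References: K. Rubin, *Euler Systems* (2000), Thm. 4.5.1, §B.3; B. Mazur, K. Rubin, Mem. AMS 799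
(2004), App. A, Prop. A.2, Remark A.5; J.-P. Serre, *Galois Cohomology*, I §2.
-/

noncomputable section

open CategoryTheory Function Finset Field IsDedekindDomain
open scoped NumberField Pointwise
open Literature.NumberTheory.GaloisRepresentations
open Literature.NumberTheory.EllipticCurves (subgroupConj subgroupConj_apply_coe subgroupInclusion)

universe u v

namespace Summit.BirchSwinnertonDyer.Rank1Residual.GaloisImage

namespace Derivative

/-! ### §1 Bookkeeping for `res_I y = 0` -/

section ResZero

variable {R : Type v} [CommRing R] [TopologicalSpace R]
variable {G : Type u} [Group G] [TopologicalSpace G] [IsTopologicalGroup G]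
variable (X : TopRep.{u} R G) (H : Subgroup G)

/-- `res_I [φ] = 0` in `H¹(I, X)` iff `φ|_I` is a coboundary: `∃ w, ∀ s ∈ I, φ(s) = s·w − w`.
[folklore] -/
theorem resLe_oneCocycleClass_eq_zero_iff {I : Subgroup G} (hIH : I ≤ H)
    (φ : contOneCocycles (subgroupRep X H)) :
    resLe X hIH 1 (oneCocycleClass _ φ) = 0 ↔
      ∃ w : X, ∀ s (hs : s ∈ I), φ.1 ⟨s, hIH hs⟩ = X.ρ s w - w := by
  rw [resLe_oneCocycleClass, oneCocycleClass_eq_zero_iff]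
  constructor
  · rintro ⟨w, hw⟩
    exact ⟨w, fun s hs => hw ⟨s, hs⟩⟩
  · rintro ⟨w, hw⟩
    exact ⟨w, fun s => hw s s.2⟩

/-- `res_I (g · y) = 0` when `res_{g⁻¹ I g} y = 0`: if `φ|_{g⁻¹Ig} = ∂w` then
`(g·φ)|_I = ∂(g·w)` (`(g·φ)(s) = g φ(g⁻¹ s g) = g((g⁻¹sg) w − w) = s (g w) − g w`). [folklore] -/
theorem resLe_conjMap_eq_zero [H.Normal] (g : G) {I I' : Subgroup G} (hIH : I ≤ H) (hI'H : I' ≤ H)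
    (hI' : ∀ s ∈ I, g⁻¹ * s * g ∈ I') {y : continuousCohomology 1 (subgroupRep X H)}
    (hy : resLe X hI'H 1 y = 0) : resLe X hIH 1 (conjMap X H g 1 y) = 0 := by
  obtain ⟨φ, rfl⟩ := oneCocycleClass_surjective _ y
  obtain ⟨w, hw⟩ := (resLe_oneCocycleClass_eq_zero_iff X H hI'H φ).mp hy
  rw [conjMap_oneCocycleClass, resLe_oneCocycleClass_eq_zero_iff]
  refine ⟨X.ρ g w, fun s hs => ?_⟩
  rw [conj_pullback_apply]
  have hconj : subgroupConj H g ⟨s, hIH hs⟩ = ⟨g⁻¹ * s * g, hI'H (hI' s hs)⟩ :=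
    Subtype.ext (subgroupConj_apply_coe H g _)
  rw [hconj, hw _ (hI' s hs), map_sub, ← ρ_mul_apply, ← ρ_mul_apply,
    show g * (g⁻¹ * s * g) = s * g by group]

variable {X' : TopRep.{u} R G}

/-- `res_I (red_* y) = 0` when `res_I y = 0`, for ANY equivariant `red : X ⟶ X′` (coefficient change
commutes with restriction, F3a `red_resLe`; no hypothesis on the action of `I`). [folklore] -/
theorem resLe_map_red_eq_zero (red : X ⟶ X') {I : Subgroup G} (hIH : I ≤ H)
    {y : continuousCohomology 1 (subgroupRep X H)} (hy : resLe X hIH 1 y = 0) :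
    resLe X' hIH 1 (ContinuousCohomology.map (ContinuousMonoidHom.id H) (X := subgroupRep X H)
      (Y := subgroupRep X' H) ((TopRep.resFunctor H.subtype).map red) 1 y) = 0 := by
  rw [← red_resLe red hIH y, hy, map_zero]

/-- `res^Γ_I = res^H_I ∘ res^Γ_H` on `H¹` (both sides are the pull-back of a cocycle to `I`).
[folklore] -/
theorem resLe_resSubgroup {I : Subgroup G} (hIH : I ≤ H) (κ : continuousCohomology 1 X) :
    resLe X hIH 1 (resSubgroup X H 1 κ) = resSubgroup X I 1 κ := by
  obtain ⟨Φ, rfl⟩ := oneCocycleClass_surjective X κ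
  rw [resSubgroup_oneCocycleClass, resLe_oneCocycleClass, resSubgroup_oneCocycleClass]
  exact congrArg _ (Subtype.ext (ContinuousMap.ext fun _ => rfl))

/-- **Stability of `{y | res_I y = 0 for all I ∈ 𝓘}` under Kolyvagin's derivative operator**
`D_r = ∏_{ℓ∈r} Σ_{j<N_ℓ} j (σ_ℓ ·)^j`, for a family `𝓘` of subgroups of `H` stable under conjugation
by `G` (F7's `noncommProd_deriv_apply_mem` on the additive subgroup). [folklore] -/
theorem forall_resLe_noncommProd_deriv_eq_zero [H.Normal] (𝓘 : Set (Subgroup G))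
    (h𝓘H : ∀ I ∈ 𝓘, I ≤ H) (h𝓘conj : ∀ I ∈ 𝓘, ∀ g : G, ∃ I' ∈ 𝓘, ∀ s ∈ I, g⁻¹ * s * g ∈ I')
    {ι : Type*} (r : Finset ι) (σ : ι → G) (N : ι → ℕ) (comm)
    {y : continuousCohomology 1 (subgroupRep X H)} (hy : ∀ I (hI : I ∈ 𝓘), resLe X (h𝓘H I hI) 1 y = 0)
    (I : Subgroup G) (hI : I ∈ 𝓘) :
    resLe X (h𝓘H I hI) 1 ((r.noncommProd (fun ℓ => ∑ j ∈ range (N ℓ),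
      (j : Module.End R (continuousCohomology 1 (subgroupRep X H))) *
        (conjMap X H (σ ℓ) 1).hom.toLinearMap ^ j) comm) y) = 0 := by
  let V : AddSubgroup (continuousCohomology 1 (subgroupRep X H)) :=
    { carrier := {z | ∀ I (hI : I ∈ 𝓘), resLe X (h𝓘H I hI) 1 z = 0}
      zero_mem' := fun I hI => map_zero _
      add_mem' := fun h₁ h₂ I hI => by rw [map_add, h₁ I hI, h₂ I hI, add_zero]
      neg_mem' := fun h₁ I hI => by rw [map_neg, h₁ I hI, neg_zero] }
  have hE : ∀ ℓ ∈ r, ∀ z ∈ V, (conjMap X H (σ ℓ) 1).hom.toLinearMap z ∈ V := by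
    intro ℓ _ z hz I hI
    obtain ⟨I', hI', hconj⟩ := h𝓘conj I hI (σ ℓ)
    exact resLe_conjMap_eq_zero X H (σ ℓ) (h𝓘H I hI) (h𝓘H I' hI') hconj (hz I' hI')
  exact noncommProd_deriv_apply_mem V r (fun ℓ => (conjMap X H (σ ℓ) 1).hom.toLinearMap) N hE comm
    y hy I hI

/-- `res_I κ = 0` iff some representative of `κ` vanishes identically on `I` (subtract the
coboundary `∂w` globally — a continuous cocycle as soon as the orbit maps `g ↦ g·w` are continuous,
`hXc`, e.g. for the `TopRep` of a `GaloisRep` / `ContinuousRep`). [folklore] -/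
theorem resSubgroup_eq_zero_iff_exists_apply_eq_zero (hXc : ∀ w : X, Continuous fun g : G => X.ρ g w)
    (I : Subgroup G) (κ : continuousCohomology 1 X) :
    resSubgroup X I 1 κ = 0 ↔ ∃ Φ : contOneCocycles X, oneCocycleClass X Φ = κ ∧ ∀ s ∈ I, Φ.1 s = 0 := by
  constructor
  · intro h
    obtain ⟨Φ, rfl⟩ := oneCocycleClass_surjective X κ
    rw [resSubgroup_oneCocycleClass, oneCocycleClass_eq_zero_iff] at h
    obtain ⟨w, hw⟩ := h
    -- the representative `Φ − ∂w`
    let δ : contOneCocycles X := ⟨⟨fun g => X.ρ g w - w, (hXc w).sub continuous_const⟩, fun g h => by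
      change X.ρ (g * h) w - w = (X.ρ g w - w) + X.ρ g (X.ρ h w - w)
      rw [map_sub, ρ_mul_apply]; abel⟩
    have hδ : oneCocycleClass X δ = 0 := (oneCocycleClass_eq_zero_iff X δ).mpr ⟨w, fun _ => rfl⟩
    refine ⟨Φ - δ, by rw [oneCocycleClass_sub, hδ, sub_zero], fun s hs => ?_⟩
    have h1 := hw ⟨s, hs⟩
    rw [contOneCocycles.pullback_apply] at h1
    change Φ.1 s = X.ρ s w - w at h1
    change Φ.1 s - (X.ρ s w - w) = 0
    rw [h1, sub_self]
  · rintro ⟨Φ, rfl, hΦ⟩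
    rw [resSubgroup_oneCocycleClass, oneCocycleClass_eq_zero_iff]
    refine ⟨0, fun s => ?_⟩
    rw [contOneCocycles.pullback_apply, map_zero, sub_zero]
    exact hΦ s s.2

end ResZero

/-! ### §2 THEOREM B-ur, class-level form -/

section Unramified

variable {K : Type u} [Field K] [NumberField K]
variable {R : Type v} [CommRing R] [TopologicalSpace R]
variable (X X' : TopRep.{u} R (absoluteGaloisGroup K)) (U : Subgroup (absoluteGaloisGroup K)) [U.Normal]

/-- **THEOREM B-ur (class level): Kolyvagin's derivative classes are unramified where the
Euler-system class is**, with NO hypothesis on the action of inertia on the coefficients.  Let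
`U ⊴ Γ_K` be open (normal) and unramified at `v`, `red : X ⟶ X′` equivariant, and `x ∈ H¹(U, X)`
with `res_{I_𝔓} x = 0` for every `𝔓 ∣ v`.  Then every `κ ∈ H¹(Γ_K, X′)` with
`res_U κ = D_r (red_* x)` (THEOREM A3's shape) satisfies `res_{I_𝔓} κ = 0 ∈ H¹(I_𝔓, X′)` for every
`𝔓 ∣ v`.  ([Rubin00] Thm. 4.5.1 / [MR04] Prop. A.2 and Remark A.5 — the structure `𝓕_u`,
unramified at every `ℓ ≠ p` — granted the input at `v`.)
[cite: Rubin2000, Thm. 4.5.1] [cite: MazurRubin2004, App. A Prop. A.2 and Remark A.5 (pp. 79–81)] -/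
theorem resSubgroup_inertia_eq_zero_of_resSubgroup_eq_deriv (red : X ⟶ X')
    {v : HeightOneSpectrum (𝓞 K)} (hvU : SubgroupIsUnramifiedAt K U v)
    (x : continuousCohomology 1 (subgroupRep X U))
    (hx : ∀ 𝔓 (h𝔓 : 𝔓 ∈ v.primesAbove), resLe X (hvU 𝔓 h𝔓) 1 x = 0)
    {ι : Type*} (r : Finset ι) (σ : ι → absoluteGaloisGroup K) (N : ι → ℕ) (comm)
    (κ : continuousCohomology 1 X')
    (hκ : resSubgroup X' U 1 κ = (r.noncommProd (fun ℓ => ∑ j ∈ range (N ℓ),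
        (j : Module.End R (continuousCohomology 1 (subgroupRep X' U))) *
          (conjMap X' U (σ ℓ) 1).hom.toLinearMap ^ j) comm)
      (ContinuousCohomology.map (ContinuousMonoidHom.id U) (X := subgroupRep X U)
        (Y := subgroupRep X' U) ((TopRep.resFunctor U.subtype).map red) 1 x))
    {𝔓 : Ideal (absIntegers (𝓞 K) K)} (h𝔓 : 𝔓 ∈ v.primesAbove) :
    resSubgroup X' (𝔓.inertia (absoluteGaloisGroup K)) 1 κ = 0 := by
  -- the family of inertia subgroups above `v`
  set 𝓘 : Set (Subgroup (absoluteGaloisGroup K)) :=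
    {I | ∃ 𝔓 ∈ v.primesAbove, I = 𝔓.inertia (absoluteGaloisGroup K)} with h𝓘_def
  have h𝓘U : ∀ I ∈ 𝓘, I ≤ U := by
    rintro I ⟨𝔓', h𝔓', rfl⟩; exact hvU 𝔓' h𝔓'
  have h𝓘conj : ∀ I ∈ 𝓘, ∀ g : absoluteGaloisGroup K, ∃ I' ∈ 𝓘, ∀ s ∈ I, g⁻¹ * s * g ∈ I' := by
    rintro I ⟨𝔓', h𝔓', rfl⟩ g
    refine ⟨(g⁻¹ • 𝔓').inertia (absoluteGaloisGroup K), ⟨g⁻¹ • 𝔓', smul_mem_primesAbove h𝔓' g⁻¹, rfl⟩,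
      fun s hs => ?_⟩
    have h := conj_mem_inertia_smul hs g⁻¹
    rwa [inv_inv] at h
  -- `red_* x`, then `D_r (red_* x)` have zero restriction to every `I ∈ 𝓘`
  have hred : ∀ I (hI : I ∈ 𝓘), resLe X' (h𝓘U I hI) 1 (ContinuousCohomology.map (ContinuousMonoidHom.id U)
      (X := subgroupRep X U) (Y := subgroupRep X' U) ((TopRep.resFunctor U.subtype).map red) 1 x) = 0 := by
    rintro I ⟨𝔓', h𝔓', rfl⟩
    exact resLe_map_red_eq_zero X U red _ (hx 𝔓' h𝔓')
  have hD := forall_resLe_noncommProd_deriv_eq_zero X' U 𝓘 h𝓘U h𝓘conj r σ N comm hred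
    (𝔓.inertia (absoluteGaloisGroup K)) ⟨𝔓, h𝔓, rfl⟩
  rw [← hκ, resLe_resSubgroup] at hD
  exact hD

/-- The class-level conclusion in F7's cocycle currency: under the hypotheses of
`resSubgroup_inertia_eq_zero_of_resSubgroup_eq_deriv`, for each `𝔓 ∣ v` SOME representative of `κ`
vanishes on `I_𝔓` — the input of F9 `SelmerFinite.localization_mem_unramifiedSubgroup_of_apply_eq_zero`
at `𝔓₀`, giving `loc_v κ ∈ H¹_ur(K_v, ·)` in `ℤ`-currency with no unramifiedness of the
coefficients. [folklore] -/
theorem exists_apply_eq_zero_of_resSubgroup_eq_deriv (red : X ⟶ X')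
    (hX'c : ∀ w : X', Continuous fun g : absoluteGaloisGroup K => X'.ρ g w)
    {v : HeightOneSpectrum (𝓞 K)} (hvU : SubgroupIsUnramifiedAt K U v)
    (x : continuousCohomology 1 (subgroupRep X U))
    (hx : ∀ 𝔓 (h𝔓 : 𝔓 ∈ v.primesAbove), resLe X (hvU 𝔓 h𝔓) 1 x = 0)
    {ι : Type*} (r : Finset ι) (σ : ι → absoluteGaloisGroup K) (N : ι → ℕ) (comm)
    (κ : continuousCohomology 1 X')
    (hκ : resSubgroup X' U 1 κ = (r.noncommProd (fun ℓ => ∑ j ∈ range (N ℓ),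
        (j : Module.End R (continuousCohomology 1 (subgroupRep X' U))) *
          (conjMap X' U (σ ℓ) 1).hom.toLinearMap ^ j) comm)
      (ContinuousCohomology.map (ContinuousMonoidHom.id U) (X := subgroupRep X U)
        (Y := subgroupRep X' U) ((TopRep.resFunctor U.subtype).map red) 1 x))
    {𝔓 : Ideal (absIntegers (𝓞 K) K)} (h𝔓 : 𝔓 ∈ v.primesAbove) :
    ∃ Φ : contOneCocycles X', oneCocycleClass X' Φ = κ ∧
      ∀ s ∈ 𝔓.inertia (absoluteGaloisGroup K), Φ.1 s = 0 :=
  (resSubgroup_eq_zero_iff_exists_apply_eq_zero X' hX'c _ κ).mp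
    (resSubgroup_inertia_eq_zero_of_resSubgroup_eq_deriv X X' U red hvU x hx r σ N comm κ hκ h𝔓)

end Unramified

end Derivative

end Summit.BirchSwinnertonDyer.Rank1Residual.GaloisImage

end
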